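import Summits.QuantumFields.YangMills.Theorems.AllWindowsColdBoxBoxHighLineTwoFormGauss
import Summits.QuantumFields.YangMills.Theorems.AllWindowsColdBoxBoxHighLineCovarianceDensityPerturbation
import Summits.QuantumFields.YangMills.Theorems.AllWindowsColdBoxBoxHighLineGaussianNormalFormOnD

/-!
# Two-form Gaussian comparison, part 3: three more mass ratios and a Cauchy–Schwarz step (for `eventInsideFP_sharp`, planner ym-idea-2 g18 (N1),
# ASSEMBLY-U5 v0.1 §3 (D′); LINE-20 U5 ⟨stmt-QuantumFields-24336⟩; U5 prep, helper-grade; U5 OPEN)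

Width seat `ym-line-sfw-p2-w4` (prover-ym-line-sfw-p2-w4-g29-0).  Re-basing the event domination ✓`SmallFieldFP.eventInsideFP` on the two-form Gaussians of
T-S5.6′ needs the PLUS mass `Z₊(δ) = ∫e^{−β((1+δ)Q + δN)}` to dominate three other masses, and a Cauchy–Schwarz step that converts the event probability under the
MINUS two-form Gaussian into the event probability under an ordinary chart Gaussian (the letters of ✓`gaussAvg` / w5's ✓`GaussianPolyTail`):
* determinants (generic real positive definite `A`, `G = A⁻¹`, part 1 ✓`TwoFormGauss.*`): `det_twoFormPlus_le` (`det((1+δ)A + δ·1) ≤ e^{δN + δ·trG}·det A`),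
  `det_le_exp_mul_det_smul` (`det A ≤ e^{2δN}·det((1−δ)A)`, `δ ≤ ½`), `det_le_exp_mul_det_twoFormMinus` (`det A ≤ e^{2δN + 4δ·trG}·det((1−δ)A − δ·1)`, `δ ≤ κ/4`);
* `integral_le_exp_mul_integral_of_det_le` — generic: precisions `2β·X`, `2β·Y` with `det Y ≤ e^E·det X` ⇒ `∫e^{−½♭aᵀ(2βX)♭a} ≤ e^{E/2}·∫e^{−½♭aᵀ(2βY)♭a}`;
* ★ the three ratios against `Z₊(δ)` (chart letters, `2752H²δ ≤ 1`, `(hodgeQ⁻¹)_{ee} ≤ C₃`): `integral_exp_smul_le_twoFormPlus` (`∫e^{−β(1−δ)Q} ≤ e^{(15+27C₃)δn}·Z₊`),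
  `integral_exp_le_twoFormPlus` (`∫e^{−βQ} ≤ …·Z₊`), `integral_exp_twoFormMinus_two_le_twoFormPlus` (`∫e^{−β((1−2δ)Q − 2δN)} ≤ …·Z₊`) — one common exponent;
* ★ `setIntegral_exp_twoFormMinus_le_sqrt` — Cauchy–Schwarz: `∫_A e^{−β((1−δ)Q − δN)} ≤ √(∫_A e^{−β(1−δ)Q}) · √(∫ e^{−β((1−2δ)Q − 2δN)})`.

Everything proved; no definitions; standard axioms.  HONEST LABEL: an input of the recorded lift (D′)/(N1) of the NEXT rung U5; U5 ⟨24336⟩, ⟨24004⟩ and the seat's own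
crux ⟨22884⟩ remain OPEN; nothing here closes a stub; **the Yang–Mills mass gap is NOT proved by this file; no summit is proved by a line.**
-/

set_option autoImplicit false

open MeasureTheory Matrix Finset Real
open scoped Kronecker

namespace Summit.QuantumFields.YangMills.Theorems.AllWindowsColdBoxBoxHighLine

namespace TwoFormGauss

open LaplaceSandwich GaussianChartWick ChartGauss

section Det

variable {ι : Type*} [Fintype ι] [DecidableEq ι]

/-- `det((1+δ)A + δ·1) ≤ e^{δ·N + δ·tr A⁻¹}·det A` (`δ ≥ 0`, `A` positive definite). -/
theorem det_twoFormPlus_le {A : Matrix ι ι ℝ} (hA : A.PosDef) {δ : ℝ} (hδ0 : 0 ≤ δ) :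
    ((1 + δ) • A + δ • (1 : Matrix ι ι ℝ)).det ≤ Real.exp (δ * Fintype.card ι + δ * (A⁻¹).trace) * A.det := by
  have hG : (A⁻¹).IsHermitian := hA.inv.isHermitian
  have h1pδ : 0 < 1 + δ := by linarith
  set μp : ℝ := δ / (1 + δ) with hμp
  have hμp0 : 0 ≤ μp := div_nonneg hδ0 h1pδ.le
  have hμpδ : μp ≤ δ := by rw [hμp, div_le_iff₀ h1pδ]; nlinarith
  have hdetA : 0 < A.det := hA.det_pos
  have htr0 : 0 ≤ (A⁻¹).trace := by
    rw [hG.trace_eq_sum_eigenvalues]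
    simp only [RCLike.ofReal_real_eq_id, id_eq]
    exact Finset.sum_nonneg fun i _ => eigenvalues_inv_nonneg hA hG i
  rw [twoForm_factor hA h1pδ.ne', det_smul, det_mul]
  have hup := det_one_add_smul_le_exp hA hG hμp0
  have h1 : (1 + δ) ^ Fintype.card ι ≤ Real.exp (δ * Fintype.card ι) := by
    calc (1 + δ) ^ Fintype.card ι ≤ Real.exp δ ^ Fintype.card ι := pow_le_pow_left₀ h1pδ.le (by linarith [Real.add_one_le_exp δ]) _
      _ = Real.exp (δ * Fintype.card ι) := by rw [← Real.exp_nat_mul]; ring_nf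
  have h2 : (1 + μp • A⁻¹).det ≤ Real.exp (δ * (A⁻¹).trace) :=
    hup.trans (Real.exp_le_exp.2 (mul_le_mul_of_nonneg_right hμpδ htr0))
  have hupnn : 0 ≤ (1 + μp • A⁻¹).det := by
    rw [det_one_add_smul_eq_prod hG]
    exact Finset.prod_nonneg fun i _ => by have := eigenvalues_inv_nonneg hA hG i; positivity
  rw [Real.exp_add]
  calc (1 + δ) ^ Fintype.card ι * (A.det * (1 + μp • A⁻¹).det)
      ≤ Real.exp (δ * Fintype.card ι) * (A.det * Real.exp (δ * (A⁻¹).trace)) :=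
        mul_le_mul h1 (mul_le_mul_of_nonneg_left h2 hdetA.le) (by positivity) (Real.exp_pos _).le
    _ = Real.exp (δ * Fintype.card ι) * Real.exp (δ * (A⁻¹).trace) * A.det := by ring

/-- `det A ≤ e^{2δN}·det((1−δ)·A)` (`0 ≤ δ ≤ ½`, `det A > 0`). -/
theorem det_le_exp_mul_det_smul {A : Matrix ι ι ℝ} (hA : A.PosDef) {δ : ℝ} (hδ0 : 0 ≤ δ) (hδ : δ ≤ 1 / 2) :
    A.det ≤ Real.exp (2 * δ * Fintype.card ι) * ((1 - δ) • A).det := by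
  have hdetA : 0 < A.det := hA.det_pos
  rw [det_smul]
  have h1 : Real.exp (-(2 * δ)) ^ Fintype.card ι ≤ (1 - δ) ^ Fintype.card ι :=
    pow_le_pow_left₀ (Real.exp_pos _).le (Literature.NumberTheory.LFunctions.Nicolas.exp_neg_two_mul_le hδ0 hδ) _
  have h2 : Real.exp (2 * δ * Fintype.card ι) * Real.exp (-(2 * δ)) ^ Fintype.card ι = 1 := by
    rw [← Real.exp_nat_mul, ← Real.exp_add]; ring_nf; exact Real.exp_zero
  calc A.det = Real.exp (2 * δ * Fintype.card ι) * Real.exp (-(2 * δ)) ^ Fintype.card ι * A.det := by rw [h2, one_mul]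
    _ ≤ Real.exp (2 * δ * Fintype.card ι) * (1 - δ) ^ Fintype.card ι * A.det := by
        exact mul_le_mul_of_nonneg_right (mul_le_mul_of_nonneg_left h1 (Real.exp_pos _).le) hdetA.le
    _ = Real.exp (2 * δ * Fintype.card ι) * ((1 - δ) ^ Fintype.card ι * A.det) := by ring

/-- `det A ≤ e^{2δN + 4δ·tr A⁻¹}·det((1−δ)A − δ·1)` for `κ|x|² ≤ xᵀAx`, `κ ≤ 1`, `0 ≤ δ ≤ κ/4`. -/
theorem det_le_exp_mul_det_twoFormMinus {A : Matrix ι ι ℝ} (hA : A.PosDef) {κ δ : ℝ} (hκ : 0 < κ) (hκ1 : κ ≤ 1)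
    (hκA : ∀ x : ι → ℝ, κ * (x ⬝ᵥ x) ≤ x ⬝ᵥ (A *ᵥ x)) (hδ0 : 0 ≤ δ) (hδ : δ ≤ κ / 4) :
    A.det ≤ Real.exp (2 * δ * Fintype.card ι + 4 * δ * (A⁻¹).trace) * ((1 - δ) • A - δ • (1 : Matrix ι ι ℝ)).det := by
  have hG : (A⁻¹).IsHermitian := hA.inv.isHermitian
  have hδ14 : δ ≤ 1 / 4 := hδ.trans (by linarith)
  have h1mδ : 0 < 1 - δ := by linarith
  set μm : ℝ := δ / (1 - δ) with hμm
  have hμm0 : 0 ≤ μm := div_nonneg hδ0 h1mδ.le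
  have hμmδ : μm ≤ 2 * δ := by rw [hμm, div_le_iff₀ h1mδ]; nlinarith
  have hdetA : 0 < A.det := hA.det_pos
  have htr0 : 0 ≤ (A⁻¹).trace := by
    rw [hG.trace_eq_sum_eigenvalues]
    simp only [RCLike.ofReal_real_eq_id, id_eq]
    exact Finset.sum_nonneg fun i _ => eigenvalues_inv_nonneg hA hG i
  have hminus : (1 - δ) • A - δ • (1 : Matrix ι ι ℝ) = (1 - δ) • (A * (1 - μm • A⁻¹)) := by
    have h := twoForm_factor hA (d := -δ) h1mδ.ne'
    rw [neg_smul, ← sub_eq_add_neg, neg_div, neg_smul, ← sub_eq_add_neg] at h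
    exact h
  have hγle : ∀ i, hG.eigenvalues i ≤ 1 / κ := eigenvalues_inv_le hA hκ hκA hG
  have hhalf : ∀ i, μm * hG.eigenvalues i ≤ 1 / 2 := by
    intro i
    have h0 := eigenvalues_inv_nonneg hA hG i
    calc μm * hG.eigenvalues i ≤ (2 * δ) * (1 / κ) := mul_le_mul hμmδ (hγle i) h0 (by linarith)
      _ ≤ 1 / 2 := by rw [mul_one_div, div_le_iff₀ hκ]; linarith
  have hlow := exp_neg_le_det_one_sub_smul hA hG hμm0 hhalf
  rw [hminus, det_smul, det_mul]
  -- `(1−δ)^N ≥ e^{−2δN}`, `det(1 − μm G) ≥ e^{−2μm tr} ≥ e^{−4δ tr}`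
  have h1 : Real.exp (-(2 * δ)) ^ Fintype.card ι ≤ (1 - δ) ^ Fintype.card ι :=
    pow_le_pow_left₀ (Real.exp_pos _).le (Literature.NumberTheory.LFunctions.Nicolas.exp_neg_two_mul_le hδ0 (by linarith)) _
  have h2 : Real.exp (-(4 * δ * (A⁻¹).trace)) ≤ (1 - μm • A⁻¹).det :=
    (Real.exp_le_exp.2 (by nlinarith [mul_le_mul_of_nonneg_right hμmδ htr0])).trans hlow
  have e1 : Real.exp (2 * δ * Fintype.card ι) * Real.exp (-(2 * δ)) ^ Fintype.card ι = 1 := by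
    rw [← Real.exp_nat_mul, ← Real.exp_add]
    ring_nf
    exact Real.exp_zero
  have e2 : Real.exp (4 * δ * (A⁻¹).trace) * Real.exp (-(4 * δ * (A⁻¹).trace)) = 1 := by
    rw [← Real.exp_add, add_neg_cancel, Real.exp_zero]
  have hR : Real.exp (2 * δ * Fintype.card ι + 4 * δ * (A⁻¹).trace) *
      (Real.exp (-(2 * δ)) ^ Fintype.card ι * (A.det * Real.exp (-(4 * δ * (A⁻¹).trace)))) = A.det := by
    calc Real.exp (2 * δ * Fintype.card ι + 4 * δ * (A⁻¹).trace) *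
          (Real.exp (-(2 * δ)) ^ Fintype.card ι * (A.det * Real.exp (-(4 * δ * (A⁻¹).trace))))
        = (Real.exp (2 * δ * Fintype.card ι) * Real.exp (-(2 * δ)) ^ Fintype.card ι) *
            (Real.exp (4 * δ * (A⁻¹).trace) * Real.exp (-(4 * δ * (A⁻¹).trace))) * A.det := by rw [Real.exp_add]; ring
      _ = A.det := by rw [e1, e2, one_mul, one_mul]
  calc A.det = Real.exp (2 * δ * Fintype.card ι + 4 * δ * (A⁻¹).trace) *
      (Real.exp (-(2 * δ)) ^ Fintype.card ι * (A.det * Real.exp (-(4 * δ * (A⁻¹).trace)))) := hR.symm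
    _ ≤ Real.exp (2 * δ * Fintype.card ι + 4 * δ * (A⁻¹).trace) * ((1 - δ) ^ Fintype.card ι * (A.det * (1 - μm • A⁻¹).det)) :=
        mul_le_mul_of_nonneg_left (mul_le_mul h1 (mul_le_mul_of_nonneg_left h2 hdetA.le) (by positivity) (pow_nonneg h1mδ.le _))
          (Real.exp_pos _).le

end Det

section Chart

variable {H : ℕ}

/-! ## Generic mass ratio from a determinant ratio -/

/-- **Generic mass ratio**: if `det Y ≤ e^E·det X` (both positive definite) then `∫e^{−½♭aᵀ(2βX)♭a} ≤ e^{E/2}·∫e^{−½♭aᵀ(2βY)♭a}` (`β > 0`). -/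
theorem integral_le_exp_mul_integral_of_det_le {X Y : Matrix (LandauFree H × Fin 3) (LandauFree H × Fin 3) ℝ} (hX : X.PosDef) (hY : Y.PosDef)
    {β E : ℝ} (hβ : 0 < β) (hdet : Y.det ≤ Real.exp E * X.det)
    {f g : (LandauFree H → E3) → ℝ} (hf : ∀ a, f a = Real.exp (-(1/2 : ℝ) * (flatten (LandauFree H) a ⬝ᵥ (((2 * β) • X) *ᵥ flatten (LandauFree H) a))))
    (hg : ∀ a, g a = Real.exp (-(1/2 : ℝ) * (flatten (LandauFree H) a ⬝ᵥ (((2 * β) • Y) *ᵥ flatten (LandauFree H) a)))) :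
    ∫ a, f a ≤ Real.exp (E / 2) * ∫ a, g a := by
  have hX' : ((2 * β) • X).PosDef := hX.smul (by positivity)
  have hY' : ((2 * β) • Y).PosDef := hY.smul (by positivity)
  rw [integral_eq_flat_of hX' hf, integral_eq_flat_of hY' hg, det_smul, det_smul]
  have h2β : 0 < (2 * β) ^ Fintype.card (LandauFree H × Fin 3) := pow_pos (by positivity) _
  have hDX : 0 < Real.sqrt ((2 * β) ^ Fintype.card (LandauFree H × Fin 3) * X.det) := Real.sqrt_pos.2 (mul_pos h2β hX.det_pos)
  have hDY : 0 < Real.sqrt ((2 * β) ^ Fintype.card (LandauFree H × Fin 3) * Y.det) := Real.sqrt_pos.2 (mul_pos h2β hY.det_pos)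
  have hsq : Real.sqrt ((2 * β) ^ Fintype.card (LandauFree H × Fin 3) * Y.det) ≤
      Real.exp (E / 2) * Real.sqrt ((2 * β) ^ Fintype.card (LandauFree H × Fin 3) * X.det) := by
    refine (Real.sqrt_le_sqrt (mul_le_mul_of_nonneg_left hdet h2β.le)).trans (le_of_eq ?_)
    have hsqrt : Real.sqrt (Real.exp E) = Real.exp (E / 2) := by
      rw [show Real.exp E = Real.exp (E / 2) ^ 2 by rw [← Real.exp_nat_mul]; ring_nf, Real.sqrt_sq (Real.exp_pos _).le]
    rw [mul_left_comm, Real.sqrt_mul (Real.exp_pos _).le, hsqrt]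
  exact ratio_div_aux (pow_nonneg (Real.sqrt_nonneg _) _) hDX hDY hsq

/-! ## Three ratios against the PLUS mass -/

/-- Common window: `2752·H²·δ ≤ 1` gives the part-1/part-2 hypotheses for both `δ` and `2δ`. -/
theorem window_aux (hH : 1 ≤ H) {δ : ℝ} (hδ0 : 0 ≤ δ) (hδ : 2752 * (H : ℝ) ^ 2 * δ ≤ 1) :
    1376 * (H : ℝ) ^ 2 * δ ≤ 1 ∧ 1376 * (H : ℝ) ^ 2 * (2 * δ) ≤ 1 ∧ δ ≤ 1 / (344 * (H : ℝ) ^ 2) / 4 ∧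
      2 * δ ≤ 1 / (344 * (H : ℝ) ^ 2) / 4 ∧ δ ≤ 1 / 2 := by
  have hH' : (1 : ℝ) ≤ H := by exact_mod_cast hH
  have hH2 : (1 : ℝ) ≤ (H : ℝ) ^ 2 := one_le_pow₀ hH'
  have hpos : (0 : ℝ) < 344 * (H : ℝ) ^ 2 := by positivity
  have hHδ : 0 ≤ (H : ℝ) ^ 2 * δ := mul_nonneg (by positivity) hδ0
  refine ⟨by nlinarith [hHδ], by nlinarith [hHδ], ?_, ?_, by nlinarith [hHδ]⟩
  · rw [div_div, le_div_iff₀ (by positivity)]; nlinarith [hHδ]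
  · rw [div_div, le_div_iff₀ (by positivity)]; nlinarith [hHδ]

/-- The exponent bookkeeping: `5δN + 9δ·tr ≤ (15 + 27C₃)·δ·n` (and the two smaller exponents too). -/
theorem exponent_aux {n N δ C₃ tr : ℝ} (hN : N = 3 * n) (hδ : 0 ≤ δ) (hn : 0 ≤ n) (htr : tr ≤ 3 * C₃ * n) (htr0 : 0 ≤ tr) :
    5 * δ * N + 9 * δ * tr ≤ (15 + 27 * C₃) * δ * n ∧ 3 * δ * N + δ * tr ≤ (15 + 27 * C₃) * δ * n ∧
      δ * N + δ * tr ≤ (15 + 27 * C₃) * δ * n := by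
  rw [hN]
  have h1 := mul_le_mul_of_nonneg_left htr hδ
  have hC₃ : 0 ≤ C₃ * n := by nlinarith
  refine ⟨by nlinarith, by nlinarith, by nlinarith⟩

/-- ★ **Ratio 1**: `∫ e^{−β(1−δ)Q} ≤ e^{(15+27C₃)δn/2} · ∫ e^{−β((1+δ)Q + δN)}`. -/
theorem integral_exp_smul_le_twoFormPlus (hH : 1 ≤ H) {β δ C₃ : ℝ} (hβ : 0 < β) (hδ0 : 0 ≤ δ) (hδ : 2752 * (H : ℝ) ^ 2 * δ ≤ 1)
    (hvar : ∀ e : LandauFree H, (hodgeQ H)⁻¹ e e ≤ C₃) :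
    ∫ a : LandauFree H → E3, Real.exp (-(β * (1 - δ) * boxQuadForm H a)) ≤
      Real.exp ((15 + 27 * C₃) * δ * Fintype.card (LandauFree H) / 2) *
        ∫ a : LandauFree H → E3, Real.exp (-(β * ((1 + δ) * boxQuadForm H a + δ * ∑ e, ‖a e‖ ^ 2))) := by
  obtain ⟨-, -, -, -, hδ12⟩ := window_aux hH hδ0 hδ
  have hA := posDef_kronecker_one (hodgeQ H) (hodgeQ_posDef H) (o := Fin 3)
  have hG : ((hodgeQ H ⊗ₖ (1 : Matrix (Fin 3) (Fin 3) ℝ))⁻¹).IsHermitian := hA.inv.isHermitian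
  have h1δ : 0 < 1 - δ := by linarith
  have hX : ((1 - δ) • (hodgeQ H ⊗ₖ (1 : Matrix (Fin 3) (Fin 3) ℝ))).PosDef := hA.smul h1δ
  have hY := (posDef_precPlus (H := H) (δ := δ) hβ hδ0)
  -- determinant ratio
  have hd1 := det_twoFormPlus_le hA hδ0
  have hd2 := det_le_exp_mul_det_smul hA hδ0 hδ12
  have htr := trace_hodgeKron_inv_le (H := H) hvar
  have htr0 : 0 ≤ ((hodgeQ H ⊗ₖ (1 : Matrix (Fin 3) (Fin 3) ℝ))⁻¹).trace := by
    rw [hG.trace_eq_sum_eigenvalues]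
    simp only [RCLike.ofReal_real_eq_id, id_eq]
    exact Finset.sum_nonneg fun i _ => eigenvalues_inv_nonneg hA hG i
  have hNn : ((Fintype.card (LandauFree H × Fin 3) : ℕ) : ℝ) = 3 * (Fintype.card (LandauFree H) : ℝ) := by
    rw [Fintype.card_prod, Fintype.card_fin]; push_cast; ring
  obtain ⟨-, hE, -⟩ := exponent_aux hNn hδ0 (Nat.cast_nonneg _) htr htr0
  have hdet : ((1 + δ) • (hodgeQ H ⊗ₖ (1 : Matrix (Fin 3) (Fin 3) ℝ)) + δ • (1 : Matrix (LandauFree H × Fin 3) (LandauFree H × Fin 3) ℝ)).det ≤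
      Real.exp ((15 + 27 * C₃) * δ * Fintype.card (LandauFree H)) * ((1 - δ) • (hodgeQ H ⊗ₖ (1 : Matrix (Fin 3) (Fin 3) ℝ))).det := by
    calc _ ≤ Real.exp (δ * Fintype.card (LandauFree H × Fin 3) + δ * ((hodgeQ H ⊗ₖ (1 : Matrix (Fin 3) (Fin 3) ℝ))⁻¹).trace) *
          (Real.exp (2 * δ * Fintype.card (LandauFree H × Fin 3)) * ((1 - δ) • (hodgeQ H ⊗ₖ (1 : Matrix (Fin 3) (Fin 3) ℝ))).det) :=
          hd1.trans (mul_le_mul_of_nonneg_left hd2 (Real.exp_pos _).le)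
      _ = Real.exp (3 * δ * Fintype.card (LandauFree H × Fin 3) + δ * ((hodgeQ H ⊗ₖ (1 : Matrix (Fin 3) (Fin 3) ℝ))⁻¹).trace) *
          ((1 - δ) • (hodgeQ H ⊗ₖ (1 : Matrix (Fin 3) (Fin 3) ℝ))).det := by
          rw [← mul_assoc, ← Real.exp_add]; ring_nf
      _ ≤ _ := mul_le_mul_of_nonneg_right (Real.exp_le_exp.2 hE) (by
          rw [det_smul]; exact mul_nonneg (pow_nonneg h1δ.le _) hA.det_pos.le)
  -- the PLUS precision in the `Y.PosDef` form (without the outer `2β`)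
  have hYin : ((1 + δ) • (hodgeQ H ⊗ₖ (1 : Matrix (Fin 3) (Fin 3) ℝ)) + δ • (1 : Matrix (LandauFree H × Fin 3) (LandauFree H × Fin 3) ℝ)).PosDef := by
    refine Matrix.PosDef.of_dotProduct_mulVec_pos (isHermitian_twoForm _ _) fun x hx => ?_
    have h1 := quadForm_le_twoFormPlus hA hδ0 x
    have h2 := hA.dotProduct_mulVec_pos hx
    rw [star_trivial] at h2 ⊢
    linarith
  refine integral_le_exp_mul_integral_of_det_le hX hYin hβ hdet (fun a => ?_) (fun a => by rw [neg_twoFormPlus_eq])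
  rw [boxQuadForm_eq_flat, Matrix.smul_mulVec, Matrix.smul_mulVec, dotProduct_smul, dotProduct_smul, smul_eq_mul, smul_eq_mul]
  ring

/-- ★ **Ratio 2**: `∫ e^{−βQ} ≤ e^{(15+27C₃)δn/2} · ∫ e^{−β((1+δ)Q + δN)}`. -/
theorem integral_exp_le_twoFormPlus {β δ C₃ : ℝ} (hβ : 0 < β) (hδ0 : 0 ≤ δ)
    (hvar : ∀ e : LandauFree H, (hodgeQ H)⁻¹ e e ≤ C₃) :
    ∫ a : LandauFree H → E3, Real.exp (-(β * boxQuadForm H a)) ≤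
      Real.exp ((15 + 27 * C₃) * δ * Fintype.card (LandauFree H) / 2) *
        ∫ a : LandauFree H → E3, Real.exp (-(β * ((1 + δ) * boxQuadForm H a + δ * ∑ e, ‖a e‖ ^ 2))) := by
  have hA := posDef_kronecker_one (hodgeQ H) (hodgeQ_posDef H) (o := Fin 3)
  have hG : ((hodgeQ H ⊗ₖ (1 : Matrix (Fin 3) (Fin 3) ℝ))⁻¹).IsHermitian := hA.inv.isHermitian
  have hd1 := det_twoFormPlus_le hA hδ0
  have htr := trace_hodgeKron_inv_le (H := H) hvar
  have htr0 : 0 ≤ ((hodgeQ H ⊗ₖ (1 : Matrix (Fin 3) (Fin 3) ℝ))⁻¹).trace := by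
    rw [hG.trace_eq_sum_eigenvalues]
    simp only [RCLike.ofReal_real_eq_id, id_eq]
    exact Finset.sum_nonneg fun i _ => eigenvalues_inv_nonneg hA hG i
  have hNn : ((Fintype.card (LandauFree H × Fin 3) : ℕ) : ℝ) = 3 * (Fintype.card (LandauFree H) : ℝ) := by
    rw [Fintype.card_prod, Fintype.card_fin]; push_cast; ring
  obtain ⟨-, -, hE⟩ := exponent_aux hNn hδ0 (Nat.cast_nonneg _) htr htr0
  have hdet : ((1 + δ) • (hodgeQ H ⊗ₖ (1 : Matrix (Fin 3) (Fin 3) ℝ)) + δ • (1 : Matrix (LandauFree H × Fin 3) (LandauFree H × Fin 3) ℝ)).det ≤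
      Real.exp ((15 + 27 * C₃) * δ * Fintype.card (LandauFree H)) * (hodgeQ H ⊗ₖ (1 : Matrix (Fin 3) (Fin 3) ℝ)).det :=
    hd1.trans (mul_le_mul_of_nonneg_right (Real.exp_le_exp.2 hE) hA.det_pos.le)
  have hYin : ((1 + δ) • (hodgeQ H ⊗ₖ (1 : Matrix (Fin 3) (Fin 3) ℝ)) + δ • (1 : Matrix (LandauFree H × Fin 3) (LandauFree H × Fin 3) ℝ)).PosDef := by
    refine Matrix.PosDef.of_dotProduct_mulVec_pos (isHermitian_twoForm _ _) fun x hx => ?_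
    have h1 := quadForm_le_twoFormPlus hA hδ0 x
    have h2 := hA.dotProduct_mulVec_pos hx
    rw [star_trivial] at h2 ⊢
    linarith
  exact integral_le_exp_mul_integral_of_det_le hA hYin hβ hdet (fun a => by rw [neg_mul_boxQuadForm_eq]) (fun a => by rw [neg_twoFormPlus_eq])

/-- ★ **Ratio 3**: `∫ e^{−β((1−2δ)Q − 2δN)} ≤ e^{(15+27C₃)δn/2} · ∫ e^{−β((1+δ)Q + δN)}`. -/
theorem integral_exp_twoFormMinus_two_le_twoFormPlus (hH : 1 ≤ H) {β δ C₃ : ℝ} (hβ : 0 < β) (hδ0 : 0 ≤ δ) (hδ : 2752 * (H : ℝ) ^ 2 * δ ≤ 1)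
    (hvar : ∀ e : LandauFree H, (hodgeQ H)⁻¹ e e ≤ C₃) :
    ∫ a : LandauFree H → E3, Real.exp (-(β * ((1 - 2 * δ) * boxQuadForm H a - 2 * δ * ∑ e, ‖a e‖ ^ 2))) ≤
      Real.exp ((15 + 27 * C₃) * δ * Fintype.card (LandauFree H) / 2) *
        ∫ a : LandauFree H → E3, Real.exp (-(β * ((1 + δ) * boxQuadForm H a + δ * ∑ e, ‖a e‖ ^ 2))) := by
  obtain ⟨-, h2δ, -, h2δκ, -⟩ := window_aux hH hδ0 hδ
  have hH' : (1 : ℝ) ≤ H := by exact_mod_cast hH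
  have hH2 : (1 : ℝ) ≤ (H : ℝ) ^ 2 := one_le_pow₀ hH'
  have hA := posDef_kronecker_one (hodgeQ H) (hodgeQ_posDef H) (o := Fin 3)
  have hG : ((hodgeQ H ⊗ₖ (1 : Matrix (Fin 3) (Fin 3) ℝ))⁻¹).IsHermitian := hA.inv.isHermitian
  have hκ0 : 0 < 1 / (344 * (H : ℝ) ^ 2) := by positivity
  have hκ1 : 1 / (344 * (H : ℝ) ^ 2) ≤ 1 := by rw [div_le_iff₀ (by positivity)]; nlinarith
  have hd1 := det_twoFormPlus_le hA hδ0
  have hd3 := det_le_exp_mul_det_twoFormMinus hA hκ0 hκ1 (hodgeKron_coercive hH) (by positivity : (0:ℝ) ≤ 2 * δ) h2δκ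
  have htr := trace_hodgeKron_inv_le (H := H) hvar
  have htr0 : 0 ≤ ((hodgeQ H ⊗ₖ (1 : Matrix (Fin 3) (Fin 3) ℝ))⁻¹).trace := by
    rw [hG.trace_eq_sum_eigenvalues]
    simp only [RCLike.ofReal_real_eq_id, id_eq]
    exact Finset.sum_nonneg fun i _ => eigenvalues_inv_nonneg hA hG i
  have hNn : ((Fintype.card (LandauFree H × Fin 3) : ℕ) : ℝ) = 3 * (Fintype.card (LandauFree H) : ℝ) := by
    rw [Fintype.card_prod, Fintype.card_fin]; push_cast; ring
  obtain ⟨hE, -, -⟩ := exponent_aux hNn hδ0 (Nat.cast_nonneg _) htr htr0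
  have hX : ((1 - 2 * δ) • (hodgeQ H ⊗ₖ (1 : Matrix (Fin 3) (Fin 3) ℝ)) -
      (2 * δ) • (1 : Matrix (LandauFree H × Fin 3) (LandauFree H × Fin 3) ℝ)).PosDef := by
    refine Matrix.PosDef.of_dotProduct_mulVec_pos ?_ fun x hx => ?_
    · rw [twoFormMinus_eq_add]; exact isHermitian_twoForm _ _
    · have h1 := quadForm_le_two_mul_minus hH (by positivity : (0:ℝ) ≤ 2 * δ) h2δ x
      have h2 := hA.dotProduct_mulVec_pos hx
      rw [star_trivial] at h2 ⊢
      linarith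
  have hYin : ((1 + δ) • (hodgeQ H ⊗ₖ (1 : Matrix (Fin 3) (Fin 3) ℝ)) + δ • (1 : Matrix (LandauFree H × Fin 3) (LandauFree H × Fin 3) ℝ)).PosDef := by
    refine Matrix.PosDef.of_dotProduct_mulVec_pos (isHermitian_twoForm _ _) fun x hx => ?_
    have h1 := quadForm_le_twoFormPlus hA hδ0 x
    have h2 := hA.dotProduct_mulVec_pos hx
    rw [star_trivial] at h2 ⊢
    linarith
  have hdet : ((1 + δ) • (hodgeQ H ⊗ₖ (1 : Matrix (Fin 3) (Fin 3) ℝ)) + δ • (1 : Matrix (LandauFree H × Fin 3) (LandauFree H × Fin 3) ℝ)).det ≤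
      Real.exp ((15 + 27 * C₃) * δ * Fintype.card (LandauFree H)) *
        ((1 - 2 * δ) • (hodgeQ H ⊗ₖ (1 : Matrix (Fin 3) (Fin 3) ℝ)) - (2 * δ) • (1 : Matrix (LandauFree H × Fin 3) (LandauFree H × Fin 3) ℝ)).det := by
    calc _ ≤ Real.exp (δ * Fintype.card (LandauFree H × Fin 3) + δ * ((hodgeQ H ⊗ₖ (1 : Matrix (Fin 3) (Fin 3) ℝ))⁻¹).trace) *
          (Real.exp (2 * (2 * δ) * Fintype.card (LandauFree H × Fin 3) + 4 * (2 * δ) * ((hodgeQ H ⊗ₖ (1 : Matrix (Fin 3) (Fin 3) ℝ))⁻¹).trace) *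
            ((1 - 2 * δ) • (hodgeQ H ⊗ₖ (1 : Matrix (Fin 3) (Fin 3) ℝ)) - (2 * δ) • (1 : Matrix (LandauFree H × Fin 3) (LandauFree H × Fin 3) ℝ)).det) :=
          hd1.trans (mul_le_mul_of_nonneg_left hd3 (Real.exp_pos _).le)
      _ = Real.exp (5 * δ * Fintype.card (LandauFree H × Fin 3) + 9 * δ * ((hodgeQ H ⊗ₖ (1 : Matrix (Fin 3) (Fin 3) ℝ))⁻¹).trace) *
          ((1 - 2 * δ) • (hodgeQ H ⊗ₖ (1 : Matrix (Fin 3) (Fin 3) ℝ)) - (2 * δ) • (1 : Matrix (LandauFree H × Fin 3) (LandauFree H × Fin 3) ℝ)).det := by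
          rw [← mul_assoc, ← Real.exp_add]; ring_nf
      _ ≤ _ := mul_le_mul_of_nonneg_right (Real.exp_le_exp.2 hE) hX.det_pos.le
  exact integral_le_exp_mul_integral_of_det_le hX hYin hβ hdet (fun a => by rw [neg_twoFormMinus_eq]) (fun a => by rw [neg_twoFormPlus_eq])

/-! ## Cauchy–Schwarz: the event under the MINUS Gaussian -/

/-- `boxQuadForm` is measurable (`= −log (gaussWeight 1 H ·)`). -/
theorem measurable_boxQuadForm : Measurable (boxQuadForm H) := by
  have h : boxQuadForm H = fun a => -Real.log (gaussWeight 1 H a) := by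
    funext a; rw [gaussWeight, Real.log_exp]; ring
  rw [h]
  exact (Real.measurable_log.comp (GaussNormalForm.measurable_gaussWeight 1 H)).neg

/-- The edge mass `a ↦ Σ_e ‖a_e‖²` is measurable. -/
theorem measurable_sum_norm_sq : Measurable fun a : LandauFree H → E3 => ∑ e, ‖a e‖ ^ 2 :=
  (continuous_finsetSum _ fun e _ => ((continuous_apply e).norm).pow 2).measurable

/-- ★ **Cauchy–Schwarz**: for a measurable event `A`, `0 ≤ δ`, `2752H²δ ≤ 1`, `β > 0`:
`∫_A e^{−β((1−δ)Q − δN)} ≤ √(∫_A e^{−β(1−δ)Q}) · √(∫ e^{−β((1−2δ)Q − 2δN)})`. -/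
theorem setIntegral_exp_twoFormMinus_le_sqrt (hH : 1 ≤ H) {β δ : ℝ} (hβ : 0 < β) (hδ0 : 0 ≤ δ) (hδ : 2752 * (H : ℝ) ^ 2 * δ ≤ 1)
    {A : Set (LandauFree H → E3)} (hA : MeasurableSet A) :
    ∫ a in A, Real.exp (-(β * ((1 - δ) * boxQuadForm H a - δ * ∑ e, ‖a e‖ ^ 2))) ≤
      Real.sqrt (∫ a in A, Real.exp (-(β * (1 - δ) * boxQuadForm H a))) *
        Real.sqrt (∫ a : LandauFree H → E3, Real.exp (-(β * ((1 - 2 * δ) * boxQuadForm H a - 2 * δ * ∑ e, ‖a e‖ ^ 2)))) := by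
  obtain ⟨-, h2δ, -, -, hδ12⟩ := window_aux hH hδ0 hδ
  have h1δ : 0 < β * (1 - δ) := mul_pos hβ (by linarith)
  -- the two factors
  set f : (LandauFree H → E3) → ℝ := fun a => A.indicator (fun _ => (1 : ℝ)) a * Real.exp (-(β * (1 - δ) * boxQuadForm H a) / 2) with hf
  set g : (LandauFree H → E3) → ℝ := fun a => Real.exp (-(β * (1 - δ) * boxQuadForm H a) / 2 + β * δ * ∑ e, ‖a e‖ ^ 2) with hg
  have hQm : Measurable (boxQuadForm H) := measurable_boxQuadForm
  have hNm : Measurable fun a : LandauFree H → E3 => ∑ e, ‖a e‖ ^ 2 := measurable_sum_norm_sq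
  have hfm : Measurable f :=
    ((measurable_const.indicator hA).mul (Real.measurable_exp.comp ((hQm.const_mul _).neg.div_const _)))
  have hgm : Measurable g :=
    Real.measurable_exp.comp (((hQm.const_mul _).neg.div_const _).add (hNm.const_mul _))
  -- `f² = 1_A e^{−β(1−δ)Q}`, integrable
  have hf2 : ∀ a, f a ^ 2 = A.indicator (fun a => Real.exp (-(β * (1 - δ) * boxQuadForm H a))) a := by
    intro a
    by_cases ha : a ∈ A
    · rw [hf]; simp only [Set.indicator_of_mem ha, one_mul]
      rw [← Real.exp_nat_mul]; ring_nf
    · rw [hf]; simp only [Set.indicator_of_notMem ha, zero_mul]; ring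
  have hfi2 : Integrable (fun a => f a ^ 2) := by
    have h := (ChartGauss.integrable_exp_neg_mul_boxQuadForm (H := H) h1δ).indicator hA
    refine h.congr (ae_of_all _ fun a => ?_)
    exact (hf2 a).symm
  -- `g² ≤ e^{−β((1−2δ)Q − 2δN)}`, integrable
  have hg2 : ∀ a, g a ^ 2 = Real.exp (-(β * (1 - δ) * boxQuadForm H a) + 2 * (β * δ * ∑ e, ‖a e‖ ^ 2)) := by
    intro a; rw [hg, ← Real.exp_nat_mul]; ring_nf
  have hg2le : ∀ a, g a ^ 2 ≤ Real.exp (-(β * ((1 - 2 * δ) * boxQuadForm H a - 2 * δ * ∑ e, ‖a e‖ ^ 2))) := by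
    intro a
    rw [hg2]
    refine Real.exp_le_exp.2 ?_
    have hQ := BoxQuadForm.boxQuadForm_nonneg hH a
    nlinarith [mul_nonneg (mul_nonneg hβ.le hδ0) hQ]
  have hgi2 : Integrable (fun a => g a ^ 2) := by
    refine (integrable_exp_twoFormMinus hH hβ (by positivity : (0:ℝ) ≤ 2 * δ) h2δ).mono' ((hgm.pow_const 2).aestronglyMeasurable)
      (ae_of_all _ fun a => ?_)
    rw [Real.norm_of_nonneg (sq_nonneg _)]
    exact hg2le a
  have hfL : MemLp f 2 volume := (memLp_two_iff_integrable_sq hfm.aestronglyMeasurable).2 hfi2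
  have hgL : MemLp g 2 volume := (memLp_two_iff_integrable_sq hgm.aestronglyMeasurable).2 hgi2
  have hCS := CovariancePerturbation.abs_integral_mul_le_sqrt_mul_sqrt hfL hgL
  -- `f·g = 1_A e^{−β((1−δ)Q − δN)}`
  have hfg : ∀ a, f a * g a = A.indicator (fun a => Real.exp (-(β * ((1 - δ) * boxQuadForm H a - δ * ∑ e, ‖a e‖ ^ 2)))) a := by
    intro a
    by_cases ha : a ∈ A
    · rw [hf, hg]; simp only [Set.indicator_of_mem ha, one_mul]
      rw [← Real.exp_add]; ring_nf
    · rw [hf]; simp only [Set.indicator_of_notMem ha, zero_mul]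
  have hlhs : ∫ a, f a * g a = ∫ a in A, Real.exp (-(β * ((1 - δ) * boxQuadForm H a - δ * ∑ e, ‖a e‖ ^ 2))) := by
    rw [← integral_indicator hA]; exact integral_congr_ae (ae_of_all _ hfg)
  have hf2int : ∫ a, f a ^ 2 = ∫ a in A, Real.exp (-(β * (1 - δ) * boxQuadForm H a)) := by
    rw [← integral_indicator hA]; exact integral_congr_ae (ae_of_all _ hf2)
  have hg2int : ∫ a, g a ^ 2 ≤ ∫ a : LandauFree H → E3, Real.exp (-(β * ((1 - 2 * δ) * boxQuadForm H a - 2 * δ * ∑ e, ‖a e‖ ^ 2))) :=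
    integral_mono hgi2 (integrable_exp_twoFormMinus hH hβ (by positivity : (0:ℝ) ≤ 2 * δ) h2δ) hg2le
  have hnn : 0 ≤ ∫ a, f a * g a := integral_nonneg fun a => by
    rw [hfg]; exact Set.indicator_nonneg (fun _ _ => (Real.exp_pos _).le) _
  rw [abs_of_nonneg hnn, hlhs, hf2int] at hCS
  exact hCS.trans (mul_le_mul_of_nonneg_left (Real.sqrt_le_sqrt hg2int) (Real.sqrt_nonneg _))

end Chart

end TwoFormGauss

end Summit.QuantumFields.YangMills.Theorems.AllWindowsColdBoxBoxHighLine
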